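import Summits.ResolutionOfSingularities.ResolutionOfSingularities.Theorems.MarkedTransferCampaignW46ThreadChainExceptionalStep
import Summits.ResolutionOfSingularities.ResolutionOfSingularities.Theorems.MarkedTransferCampaignW46ThreadChainValuation
import Literature.AlgebraicGeometry.Resolution.QuadraticSequenceDimOneExistence
import Mathlib.RingTheory.LocalRing.ResidueField.Basic
import HarnessLib

/-!
# [OURS · L1 W4.6 rung (i-a)] Thread chains, VII: a curve followed forever — the residue images of the chain in the
# residue field of the prime divisor (setup of the followed-curve end game)
# (cell res-hironaka, LADDER-RESOLUTION rung L, D-0089; campaign s46, prover res-L1-s46-pv-1; host route MarkedTransfer,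
# `--supports stmt-ResolutionOfSingularities-16155`)

HONEST FRAMING. Nothing here is a statement of H. Hironaka's manuscript (2017-03-23, [Hironaka2017]). Pure commutative
algebra inside a field `F` about the thread chains `IsThreadChain b R J` of `MarkedTransferCampaignW46ThreadChain.lean`.
AI review is weaker than expert review. No `sorry`; axioms standard.

## Setting (Herrmann–Ikeda–Orbanz, proof of Thm. (30.2); Zariski's branch following)

A thread chain `R 0 → R 1 → ⋯` all of whose members from stage `N` on lie in one local subring `W ⊆ F` (in the
application: the prime divisor `(R N)_{(π)}` of a curve through the point of stage `N` which the chain FOLLOWS forever).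
Then the valuation ring `O = ⋃ R k` of the chain lies in `W`, and reduction modulo `𝔪_W` sends the chain to an
increasing sequence of subrings `θ(R k)` of the residue field `κ(W)`, whose union `θ(O)` is a valuation ring of `κ(W)`
(`residueImage`) dominating every `θ(R k)`.

## Contents

* `residueMap` — `θ : S → κ(W)` for `S ⊆ W`; `residueImage` — the valuation ring `θ(O) ⊆ κ(W)`.
* `IsThreadChain.le_of_forall_le` (`O ⊆ W`), `inv_not_mem_of_mem_maximalIdeal` (`𝔪_W ∩ O ⊆ 𝔪_O`),
  `inv_mem_residueImage_iff` (**domination**: `θ(z)`, `z ∈ S`, is a unit of `θ(O)` iff `z` is a unit of `S`, for `S`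
  dominated by `O`), `exists_residueMap_eq` / `exists_finset_subset_range` (`θ(O) = ⋃ θ(R k)`).
* `isDiscreteValuationRing_of_subringDominates` — **`V = N_𝔫`** (Herrmann–Ikeda–Orbanz, proof of Thm. (30.2), for a
  PRESCRIBED valuation ring; the tree's `exists_valuationSubring_dominates_of_finite_integralClosure` constructs some
  such ring): a valuation ring `V` of a field `L` dominating a one-dimensional Noetherian local domain `A ⊆ L` with
  `Frac A = L` and module-finite normalization `N` is a discrete valuation ring, `N ⊆ V` is finitely generated over
  `A`, and every element of `V` is `y/z` with `y, z ∈ N`, `z` a unit of `V` (Krull–Akizuki: `N` is Dedekind; the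
  localization of `N` at the centre of `V` is a discrete valuation ring inside `V` dominated by `V`, hence equal to it).

## References

* M. Herrmann, S. Ikeda, U. Orbanz, *Equimultiplicity and Blowing up* (1988), proof of Thm. (30.2). [HerrmannIkedaOrbanz1988]
* O. Zariski, P. Samuel, *Commutative Algebra* II (1960), Appendix 5. [ZariskiSamuel1960]
-/

noncomputable section

set_option linter.dupNamespace false -- mandated namespace of this single-conjunct summit

open IsLocalRing

namespace Summit.ResolutionOfSingularities.ResolutionOfSingularities.Theorems

namespace CampaignW46

open Literature.AlgebraicGeometry.Resolution Literature.RingTheory.DiscreteValuationRing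

universe u

variable {F : Type u} [Field F]

/-! ## The residue map and the residue image of a valuation ring -/

/-- [OURS · L1 W4.6 rung (i-a)] NOT a statement of the manuscript. The residue map `θ : S → κ(W)` of a subring `S` of
the local subring `W ⊆ F`. [folklore] -/
def residueMap (W : LocalSubring F) {S : Subring F} (hS : S ≤ W.toSubring) : S →+* ResidueField W.toSubring :=
  (residue W.toSubring).comp (Subring.inclusion hS)

/-- Unfolding `residueMap`. [folklore] -/
theorem residueMap_apply (W : LocalSubring F) {S : Subring F} (hS : S ≤ W.toSubring) (z : S) :
    residueMap W hS z = residue W.toSubring (Subring.inclusion hS z) := rfl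

/-- The residue maps are compatible with inclusions `S ≤ S' ≤ W`. [folklore] -/
theorem residueMap_inclusion (W : LocalSubring F) {S S' : Subring F} (hS : S ≤ W.toSubring) (hS' : S' ≤ W.toSubring)
    (hSS' : S ≤ S') (z : S) : residueMap W hS' (Subring.inclusion hSS' z) = residueMap W hS z := rfl

/-- `θ(z) = 0` iff `z ∈ 𝔪_W`. [folklore] -/
theorem residueMap_eq_zero_iff (W : LocalSubring F) {S : Subring F} (hS : S ≤ W.toSubring) (z : S) :
    residueMap W hS z = 0 ↔ Subring.inclusion hS z ∈ maximalIdeal W.toSubring := by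
  rw [residueMap_apply, residue_eq_zero_iff]

/-- `θ(z) ≠ 0` iff `z⁻¹ ∈ W` (for `z ≠ 0`). [folklore] -/
theorem residueMap_ne_zero_iff (W : LocalSubring F) {S : Subring F} (hS : S ≤ W.toSubring) {z : S} (hz0 : (z : F) ≠ 0) :
    residueMap W hS z ≠ 0 ↔ (z : F)⁻¹ ∈ W.toSubring := by
  rw [Ne, residueMap_eq_zero_iff, mem_maximalIdeal_iff_inv_not_mem]
  push Not
  exact ⟨fun h => h.2, fun h => ⟨hz0, h⟩⟩

/-- [OURS · L1 W4.6 rung (i-a)] NOT a statement of the manuscript. **The residue image `θ(O) ⊆ κ(W)` of a valuation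
ring `O ⊆ W` of `F`**, a valuation ring of the residue field `κ(W)`. [folklore] -/
def residueImage (O : ValuationSubring F) (W : LocalSubring F) (hOW : O.toSubring ≤ W.toSubring) :
    ValuationSubring (ResidueField W.toSubring) where
  toSubring := (residueMap W hOW).range
  mem_or_inv_mem' := by
    intro c
    obtain ⟨w, rfl⟩ := residue_surjective (R := W.toSubring) c
    rcases O.mem_or_inv_mem (w : F) with hw | hw
    · exact Or.inl ⟨⟨w, hw⟩, rfl⟩
    · right
      by_cases hw0 : (w : F) = 0
      · have : w = 0 := Subtype.ext hw0
        rw [this, map_zero, inv_zero]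
        exact (residueMap W hOW).range.zero_mem
      refine ⟨⟨(w : F)⁻¹, hw⟩, ?_⟩
      have hmul : w * ⟨(w : F)⁻¹, hOW hw⟩ = 1 := Subtype.ext (mul_inv_cancel₀ hw0)
      have h1 := congrArg (residue W.toSubring) hmul
      rw [map_mul, map_one] at h1
      exact (inv_eq_of_mul_eq_one_right h1).symm

/-- Membership in the residue image. [folklore] -/
theorem mem_residueImage_iff {O : ValuationSubring F} {W : LocalSubring F} (hOW : O.toSubring ≤ W.toSubring)
    (c : ResidueField W.toSubring) : c ∈ residueImage O W hOW ↔ ∃ z : O.toSubring, residueMap W hOW z = c :=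
  Iff.rfl

namespace IsThreadChain

variable {b : ℕ} {R : ℕ → Subring F} {J : ∀ k, Ideal (R k)} (h : IsThreadChain b R J)
include h

/-! ## A local subring containing the tail of the chain -/

/-- **`O ⊆ W`**: if every `R k`, `k ≥ N`, lies in the local subring `W`, so does the valuation ring `O = ⋃ R k` of the
chain. [folklore] -/
theorem le_of_forall_le {O : ValuationSubring F} (hO : ∀ k, SubringDominates (R k) O.toSubring) {W : LocalSubring F}
    {N : ℕ} (hall : ∀ k, N ≤ k → R k ≤ W.toSubring) : O.toSubring ≤ W.toSubring := by
  intro z hz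
  obtain ⟨k, hk⟩ := (h.mem_iff_exists_mem hO z).mp hz
  exact hall (max k N) (le_max_right _ _) (h.mono (le_max_left _ _) hk)

omit h in
/-- `𝔪_W ∩ O ⊆ 𝔪_O`: a non-unit of `W` lying in `O` is a non-unit of `O`. [folklore] -/
theorem _root_.Summit.ResolutionOfSingularities.ResolutionOfSingularities.Theorems.CampaignW46.inv_not_mem_of_mem_maximalIdeal
    {O : ValuationSubring F} {W : LocalSubring F} (hOW : O.toSubring ≤ W.toSubring) {z : F} (hzO : z ∈ O)
    (hzm : (⟨z, hOW hzO⟩ : W.toSubring) ∈ maximalIdeal W.toSubring) (hz0 : z ≠ 0) : z⁻¹ ∉ O := by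
  intro hzi
  rcases (mem_maximalIdeal_iff_inv_not_mem _).mp hzm with h0 | hni
  · exact hz0 h0
  · exact hni (hOW hzi)

omit h in
/-- **Domination of the residue images.** For a local subring `S` of `F` dominated by the valuation ring `O ⊆ W`:
`θ(z)`, `z ∈ S`, is a unit of the residue image `θ(O)` iff `z` is a unit of `S`. [folklore] -/
theorem _root_.Summit.ResolutionOfSingularities.ResolutionOfSingularities.Theorems.CampaignW46.inv_mem_residueImage_iff
    {O : ValuationSubring F} {W : LocalSubring F} (hOW : O.toSubring ≤ W.toSubring) {S : Subring F}
    (hSO : SubringDominates S O.toSubring) (z : S) (hz : residueMap W (hSO.1.trans hOW) z ≠ 0) :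
    (residueMap W (hSO.1.trans hOW) z)⁻¹ ∈ residueImage O W hOW ↔ (z : F)⁻¹ ∈ S := by
  have hz0 : (z : F) ≠ 0 := by
    intro h0; apply hz; rw [show z = 0 from Subtype.ext h0, map_zero]
  haveI : IsLocalRing O.toSubring := show IsLocalRing O from inferInstance
  constructor
  · rintro ⟨w, hw⟩
    -- `θ(w) θ(z) = 1`: so `w z - 1 ∈ 𝔪_W ∩ O ⊆ 𝔪_O`; were `z` a non-unit of `O`, `1 ∈ 𝔪_O`
    refine hSO.2 (z : F) z.2 ?_
    by_contra hzinvO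
    have hzO : (z : F) ∈ O := hSO.1 z.2
    set zO : O.toSubring := ⟨(z : F), hzO⟩ with hzOdef
    have hprod : residueMap W hOW (w * zO) = 1 := by
      rw [map_mul, hw, show residueMap W hOW zO = residueMap W (hSO.1.trans hOW) z from rfl, inv_mul_cancel₀ hz]
    have hsub : residueMap W hOW (w * zO - 1) = 0 := by rw [map_sub, hprod, map_one, sub_self]
    rw [residueMap_eq_zero_iff] at hsub
    have h1 : w * zO ∈ maximalIdeal O.toSubring :=
      Ideal.mul_mem_left _ w ((mem_maximalIdeal_iff_inv_not_mem zO).mpr (Or.inr hzinvO))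
    have h2 : w * zO - 1 ∈ maximalIdeal O.toSubring := by
      rw [mem_maximalIdeal_iff_inv_not_mem]
      by_cases h0 : ((w * zO - 1 : O.toSubring) : F) = 0
      · exact Or.inl h0
      · exact Or.inr (inv_not_mem_of_mem_maximalIdeal hOW (w * zO - 1).2 hsub h0)
    have h3 : (1 : O.toSubring) ∈ maximalIdeal O.toSubring := by
      have e : (1 : O.toSubring) = w * zO - (w * zO - 1) := by ring
      rw [e]; exact Ideal.sub_mem _ h1 h2
    exact (maximalIdeal.isMaximal _).ne_top (Ideal.eq_top_of_isUnit_mem _ h3 isUnit_one)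
  · intro hzinv
    refine ⟨⟨(z : F)⁻¹, hSO.1 hzinv⟩, ?_⟩
    have hmul : residueMap W (hSO.1.trans hOW) z * residueMap W hOW ⟨(z : F)⁻¹, hSO.1 hzinv⟩ = 1 := by
      rw [residueMap_apply, residueMap_apply, ← map_mul, ← map_one (residue W.toSubring)]
      congr 1
      exact Subtype.ext (mul_inv_cancel₀ hz0)
    exact (inv_eq_of_mul_eq_one_right hmul).symm

omit h in
/-- The residue image of a member of the chain lies in `θ(O)`. [folklore] -/
theorem residueMap_mem_residueImage {O : ValuationSubring F} (hO : ∀ k, SubringDominates (R k) O.toSubring)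
    {W : LocalSubring F} (hOW : O.toSubring ≤ W.toSubring) (k : ℕ) (z : R k) :
    residueMap W ((hO k).1.trans hOW) z ∈ residueImage O W hOW :=
  ⟨⟨(z : F), (hO k).1 z.2⟩, rfl⟩

/-- **`θ(O) = ⋃ θ(R k)`**: every element of the residue image comes from some member `R k`, `k ≥ N`. [folklore] -/
theorem exists_residueMap_eq {O : ValuationSubring F} (hO : ∀ k, SubringDominates (R k) O.toSubring)
    {W : LocalSubring F} (hOW : O.toSubring ≤ W.toSubring) (N : ℕ) {c : ResidueField W.toSubring}
    (hc : c ∈ residueImage O W hOW) : ∃ k, N ≤ k ∧ ∃ z : R k, residueMap W ((hO k).1.trans hOW) z = c := by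
  obtain ⟨w, rfl⟩ := hc
  obtain ⟨k, hk⟩ := (h.mem_iff_exists_mem hO (w : F)).mp w.2
  exact ⟨max k N, le_max_right _ _, ⟨(w : F), h.mono (le_max_left _ _) hk⟩, rfl⟩

/-- A finite set of elements of `θ(O)` comes from one member `R k`, `k ≥ N`. [folklore] -/
theorem exists_finset_subset_range {O : ValuationSubring F} (hO : ∀ k, SubringDominates (R k) O.toSubring)
    {W : LocalSubring F} (hOW : O.toSubring ≤ W.toSubring) (N : ℕ) (T : Finset (ResidueField W.toSubring))
    (hT : ∀ c ∈ T, c ∈ residueImage O W hOW) :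
    ∃ k, N ≤ k ∧ ∀ c ∈ T, c ∈ (residueMap W ((hO k).1.trans hOW)).range := by
  classical
  choose! ι hιN hι using fun c (hc : c ∈ T) => h.exists_residueMap_eq hO hOW N (hT c hc)
  refine ⟨T.sup ι ⊔ N, le_sup_right, fun c hc => ?_⟩
  obtain ⟨z, hz⟩ := hι c hc
  have hle : R (ι c) ≤ R (T.sup ι ⊔ N) := h.mono ((Finset.le_sup hc).trans le_sup_left)
  exact ⟨Subring.inclusion hle z, hz⟩

end IsThreadChain

/-! ## A valuation ring dominating a one-dimensional local domain with finite normalization is a discrete valuation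
ring, the localization of the normalization at a maximal ideal -/

section Normalization

variable {L : Type u} [Field L]

/-- **`V = N_𝔫`** (Herrmann–Ikeda–Orbanz, proof of Thm. (30.2), for a GIVEN valuation ring). Let `A ⊆ L` be a
one-dimensional Noetherian local domain with fraction field `L`, not a field, with module-finite integral closure `N`,
and `V` a valuation ring of `L` dominating `A`. Then `V` is a discrete valuation ring — the localization of the
Dedekind domain `N` at the maximal ideal `𝔫 = 𝔪_V ∩ N` — and `N ⊆ V` is generated over `A` by a finite set, with every
element of `V` a quotient `y/z`, `y, z ∈ N`, `z` a unit of `V`. (The tree's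
`exists_valuationSubring_dominates_of_finite_integralClosure` constructs SOME such `V`; here `V` is prescribed.)
[cite: HerrmannIkedaOrbanz1988, Thm. (30.2) (proof)] -/
theorem isDiscreteValuationRing_of_subringDominates {A : Subring L} [IsNoetherianRing A] [Ring.KrullDimLE 1 A]
    (hof : IsLocalRingOf A) (hA : ¬ IsField A) (hfin : Module.Finite A (integralClosure A L))
    (V : ValuationSubring L) (hAV : SubringDominates A V.toSubring) :
    IsDiscreteValuationRing V ∧ ∃ (N : Subring L) (S : Finset L), N ≤ V.toSubring ∧ (S : Set L) ⊆ N ∧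
      N ≤ Subring.closure ((A : Set L) ∪ ↑S) ∧ V.toSubring ≤ locAtCentre N V := by
  classical
  haveI : IsLocalRing A := hof.1
  haveI : IsFractionRing A L := isFractionRing_of_isLocalRingOf_le hof.2 le_rfl
  haveI : Ring.DimensionLEOne A := dimensionLEOne_subring
  haveI : IsDedekindDomain (integralClosure A L) :=
    KrullAkizuki_holds.isDedekindDomain_integralClosure hA L L
  have hinj : Function.Injective (algebraMap A (integralClosure A L)) := fun x y hxy =>
    Subtype.ext (congrArg (fun c : integralClosure A L => (c : L)) hxy)
  have hdomv := (subringDominates_valuationSubring_iff hAV.1).mp hAV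
  -- `N ⊆ V` (valuation rings are integrally closed)
  have hNV : ∀ c : integralClosure A L, (c : L) ∈ V := by
    intro c
    have hle : A ≤ V.valuation.integer := by rw [ValuationSubring.integer_valuation]; exact hAV.1
    have hint : IsIntegral V.valuation.integer (c : L) := by
      obtain ⟨p, hp, hpc⟩ := c.2
      refine ⟨p.map (Subring.inclusion hle), hp.map _, ?_⟩
      rw [Polynomial.eval₂_map]
      exact hpc
    have := Valuation.Integers.mem_of_integral (Valuation.integer.integers V.valuation) hint
    rwa [ValuationSubring.integer_valuation] at this
  -- the centre `Q = 𝔪_V ∩ N`, a non-zero prime of the Dedekind domain `N`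
  set Q : Ideal (integralClosure A L) :=
    { carrier := {c | V.valuation (c : L) < 1}
      zero_mem' := by simp
      add_mem' := by
        intro c d hc hd
        simp only [Set.mem_setOf_eq, Subalgebra.coe_add] at hc hd ⊢
        exact (Valuation.map_add _ _ _).trans_lt (max_lt hc hd)
      smul_mem' := by
        intro c d hd
        simp only [Set.mem_setOf_eq, smul_eq_mul, Subalgebra.coe_mul, map_mul] at hd ⊢
        calc V.valuation (c : L) * V.valuation (d : L) ≤ 1 * V.valuation (d : L) :=
              mul_le_mul' ((V.valuation_le_one_iff _).mpr (hNV c)) le_rfl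
          _ < 1 := by rw [one_mul]; exact hd } with hQ
  have hmemQ : ∀ c : integralClosure A L, c ∈ Q ↔ V.valuation (c : L) < 1 := fun c => Iff.rfl
  have hnotQ : ∀ c : integralClosure A L, c ∉ Q ↔ V.valuation (c : L) = 1 := by
    intro c
    rw [hmemQ, not_lt]
    exact ⟨fun h => le_antisymm ((V.valuation_le_one_iff _).mpr (hNV c)) h, fun h => h.ge⟩
  haveI hQp : Q.IsPrime := by
    refine ⟨fun htop => ?_, fun {c d} hcd => ?_⟩
    · have h1 : (1 : integralClosure A L) ∈ Q := htop ▸ Submodule.mem_top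
      rw [hmemQ, Subalgebra.coe_one, map_one] at h1
      exact lt_irrefl _ h1
    · by_contra hor
      have hc : c ∉ Q := fun h => hor (Or.inl h)
      have hd : d ∉ Q := fun h => hor (Or.inr h)
      rw [hnotQ] at hc hd
      rw [hmemQ, Subalgebra.coe_mul, map_mul, hc, hd, one_mul] at hcd
      exact lt_irrefl _ hcd
  have hQne : Q ≠ ⊥ := by
    have hmne : maximalIdeal A ≠ ⊥ := fun hm => hA (IsLocalRing.isField_iff_maximalIdeal_eq.mpr hm)
    obtain ⟨a, ham, ha0⟩ := Submodule.exists_mem_ne_zero_of_ne_bot hmne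
    intro hQbot
    have haQ : algebraMap A (integralClosure A L) a ∈ Q := by
      rw [hmemQ]; exact (hdomv a).mp ham
    rw [hQbot, Ideal.mem_bot] at haQ
    exact ha0 (hinj (by rw [haQ, map_zero]))
  -- `𝒪 = N_Q ⊆ L`, a discrete valuation ring contained in `V` and dominated by `V`
  let 𝒪 : Subalgebra (integralClosure A L) L :=
    Localization.subalgebra.ofField L Q.primeCompl Q.primeCompl_le_nonZeroDivisors
  haveI : IsLocalization.AtPrime 𝒪 Q := Localization.subalgebra.isLocalization_ofField L _ _
  haveI : IsDiscreteValuationRing 𝒪 :=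
    IsLocalization.AtPrime.isDiscreteValuationRing_of_dedekind_domain _ hQne 𝒪
  have hC𝒪 : ∀ c : integralClosure A L, (c : L) ∈ 𝒪 := fun c => 𝒪.algebraMap_mem c
  have hA𝒪 : ∀ a : A, (a : L) ∈ 𝒪 := fun a => hC𝒪 (algebraMap A (integralClosure A L) a)
  haveI : IsFractionRing 𝒪 L := by
    refine IsFractionRing.of_field 𝒪 L fun z => ?_
    obtain ⟨a, ha, b, hb, -, rfl⟩ := hof.2 z
    exact ⟨⟨a, hA𝒪 ⟨a, ha⟩⟩, ⟨b, hA𝒪 ⟨b, hb⟩⟩, rfl⟩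
  have hmem_or : ∀ z : L, z ∈ 𝒪 ∨ z⁻¹ ∈ 𝒪 := by
    intro z
    rcases ValuationRing.isInteger_or_isInteger 𝒪 z with ⟨y, hy⟩ | ⟨y, hy⟩
    · exact Or.inl (hy ▸ y.2)
    · exact Or.inr (hy ▸ y.2)
  -- `𝒪 ⊆ V`
  have hinvV : ∀ t : integralClosure A L, t ∉ Q → ((t : L))⁻¹ ∈ V := by
    intro t ht
    rw [hnotQ] at ht
    have ht0 : (t : L) ≠ 0 := ne_zero_of_valuation_eq_one ht
    rw [← V.valuation_le_one_iff, map_inv₀, ht, inv_one]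
  have h𝒪V : ∀ z : L, z ∈ 𝒪 → z ∈ V := by
    intro z hz
    obtain ⟨a, t, ht, rfl⟩ := (show z ∈ 𝒪 from hz)
    exact V.toSubring.mul_mem (hNV a) (hinvV t ht)
  -- `V` dominates `𝒪`, hence `V = 𝒪`
  have hV𝒪 : ∀ z : L, z ∈ V → z ∈ 𝒪 := by
    intro z hz
    rcases hmem_or z with hz𝒪 | hz𝒪
    · exact hz𝒪
    · by_cases hz0 : z = 0
      · rw [hz0]; exact 𝒪.zero_mem
      obtain ⟨a, t, ht, he⟩ := (show z⁻¹ ∈ 𝒪 from hz𝒪)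
      -- `a = z⁻¹ t` is a unit of `V`, so `a ∉ Q` and `z = t a⁻¹ ∈ 𝒪`
      have ht1 : V.valuation (t : L) = 1 := (hnotQ t).mp ht
      have ha : a ∉ Q := by
        rw [hnotQ]
        have : (a : L) = z⁻¹ * t := by
          rw [he]
          change (a : L) = (a : L) * ((t : L))⁻¹ * t
          rw [mul_assoc, inv_mul_cancel₀ (ne_zero_of_valuation_eq_one ht1), mul_one]
        rw [this, map_mul, map_inv₀, ht1, mul_one]
        have hzv : V.valuation z ≤ 1 := (V.valuation_le_one_iff _).mpr hz
        have hziv : V.valuation z⁻¹ ≤ 1 := (V.valuation_le_one_iff _).mpr (h𝒪V _ hz𝒪)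
        rw [map_inv₀, inv_le_one₀ (pos_iff_ne_zero.mpr ((map_ne_zero _).mpr hz0))] at hziv
        rw [← map_inv₀]
        rw [map_inv₀]; exact inv_eq_one.mpr (le_antisymm hzv hziv)
      have : z = (t : L) * ((a : L))⁻¹ := by
        have e : z⁻¹ = (a : L) * ((t : L))⁻¹ := he
        have := congrArg Inv.inv e
        rw [inv_inv, mul_inv, inv_inv, mul_comm] at this
        exact this
      rw [this]
      exact ⟨t, a, ha, rfl⟩
  have heq : ∀ z : L, z ∈ V ↔ z ∈ 𝒪 := fun z => ⟨hV𝒪 z, h𝒪V z⟩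
  -- transfer the DVR structure
  have hdvr : IsDiscreteValuationRing V :=
    IsDiscreteValuationRing.RingEquivClass.isDiscreteValuationRing (A := 𝒪) (B := V)
      ({ toFun := fun x => ⟨x.1, (heq x.1).mpr x.2⟩, invFun := fun x => ⟨x.1, (heq x.1).mp x.2⟩,
         left_inv := fun _ => rfl, right_inv := fun _ => rfl, map_mul' := fun _ _ => rfl,
         map_add' := fun _ _ => rfl } : 𝒪 ≃+* V)
  -- generators of `N` over `A`
  obtain ⟨s, hs⟩ := Module.Finite.fg_top (R := A) (M := integralClosure A L)
  refine ⟨hdvr, (integralClosure A L).toSubring, s.image (fun c : integralClosure A L => (c : L)), ?_, ?_, ?_, ?_⟩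
  · intro c hc; exact hNV ⟨c, hc⟩
  · intro x hx
    rw [Finset.coe_image] at hx
    obtain ⟨c, -, rfl⟩ := hx
    exact c.2
  · have key : ∀ x ∈ Submodule.span A (s : Set (integralClosure A L)),
        (x : L) ∈ Subring.closure ((A : Set L) ∪ ↑(s.image fun c : integralClosure A L => (c : L))) := by
      intro x hx
      induction hx using Submodule.span_induction with
      | mem x hx =>
        refine Subring.subset_closure (Or.inr ?_)
        rw [Finset.coe_image]
        exact ⟨x, hx, rfl⟩
      | zero => exact Subring.zero_mem _
      | add x y _ _ hx hy => exact Subring.add_mem _ hx hy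
      | smul a x _ hx =>
        change ((a : L) * (x : L)) ∈ _
        exact Subring.mul_mem _ (Subring.subset_closure (Or.inl a.2)) hx
    intro c hc
    have hcmem : (⟨c, hc⟩ : integralClosure A L) ∈ Submodule.span A (s : Set (integralClosure A L)) := by
      rw [hs]; exact Submodule.mem_top
    exact key _ hcmem
  · intro z hz
    obtain ⟨a, t, ht, he⟩ := (show z ∈ 𝒪 from hV𝒪 z hz)
    exact ⟨(a : L), a.2, (t : L), t.2, (hnotQ t).mp ht, by rw [div_eq_mul_inv]; exact he⟩

end Normalization

end CampaignW46

end Summit.ResolutionOfSingularities.ResolutionOfSingularities.Theorems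

end
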